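import Summits.NavierStokesRegularity.FunctionalMining.StretchingLaminateL1SuperLine
import HarnessLib

/-!
# FunctionalMining — K1-Q1 laminates, L1 port 3/18 — Part E (member form U = φ_θ + W: (S2), (S1), (LC) ⇒ laminateSupConst ≤ θ)

search for candidate a priori estimates; no regularity claim.

Cell `pub-nsfunc` (host summit NavierStokesRegularity, topic `FunctionalMining`); PORT COPY of the bank seat's scratch
`HOME/pub-nsfunc-bank/tools/lam/upper/u4t/L1-SUPERSOLUTION.scratch.lean` (generic r11, sha16 c63cd257e1f26cb9), lines 717–830,
verbatim EXCEPT docstrings (overlay `u4t/port/docstrings_r11.json` c4f7e1e1d014a584 = split plan `u4t/PORT-SPLIT-PLAN.md` §4 (E2)/(E3):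
new one-line docstrings on formerly undocumented helpers + refreshed hypothesis/proved-downstream docstrings on the `Prop`s;
provenance tags `[ours; …]` appended to every other docstring (tags `u4t/port/tags_r11.json` 7935c0e35cdf68ee, census-2 port note P-B1);
bodies byte-identical to the scratch modulo docstrings — machine-verified by `split_r11.py --overlay`; census readings carry over).

CONTENT (Part E, the MEMBER FORM of `CERTIFICATE-MAP-R18.md` §1).
`ratioBound_of_member (θ) (W) (hS2) (hS1) (hsmooth) (hLC) : RatioBound θ` and
`laminateSupConst_le_of_member` for `U := φ_θ + W`: (S2) `W 0 0 ≤ 0`, (S1) `0 ≤ W` on the closed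
ball × {symmetric trace-free}, `C²` along admissible lines, (LC)
`2·wᵀYw + ∂²_τ W(x + τw, Y + τK)|₀ ≤ θ` at `|x| < 1` for unit orthogonal `(c, n)`. Inside:
`iteratedDeriv_two_payoff_line` (`(lineFun φ_θ)''(0) = 2wᵀYw − θ|w|²`: the cubic coefficient
`dirW_dirK_dirW` and the cross terms `cross_dirK_dirW` vanish), `iteratedDeriv_two_cubic`.
Everything in this file is PROVED; the four hypotheses are binders — the R18 files below instantiate
`W` and discharge (S2) and smoothness.

WORDS AT LANDING (LEAD (κκκκ)(iii)): records — conditional reduction: laminateSupConst ≤ theta1 GIVEN the two engine legs in the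
engines' own charts; (C-b) cell-union arithmetic and (C-c) per-box engine soundness are NOT in the kernel; ‹C_lam ≤ 0.78› NOT
claimed (L4/L5 by format, referee, LEAD-human gate); numbers of record unchanged.  Every `def … : Prop` named `R18_…` / `Row…` /
`…Rows…` below is a HYPOTHESIS = an engine-certified (or pen) claim, NOT proved in this file unless a `…_holds` theorem says so.
-/

noncomputable section

open Matrix

namespace Summit.NavierStokesRegularity.FunctionalMining

namespace Laminate

/-! ## Part E — member form: `U = φ_θ + W` with (S2) `W(0,0) ≤ 0`, (S1) `0 ≤ W`, (LC) `2wᵀYw + ∂²W ≤ θ` (CERTIFICATE-MAP §1 verbatim) -/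

section memberForm

/-- `wᵀ K w = 0` for the admissible pair `(w, K) = (n × c, sym(c⊗n))` (`w ⊥ c, n`). [ours; elementary] -/
theorem dirW_dirK_dirW (c n : Vec3) : dirW c n ⬝ᵥ (dirK c n *ᵥ dirW c n) = 0 := by
  simp [dirW, dirK, dotProduct, Matrix.mulVec, Fin.sum_univ_three]; ring

/-- `xᵀ K w + wᵀ K x = 0` for the admissible pair (`K w = (c (n·w) + n (c·w))/2 = 0`). [ours; elementary] -/
theorem cross_dirK_dirW (x c n : Vec3) :
    x ⬝ᵥ (dirK c n *ᵥ dirW c n) + dirW c n ⬝ᵥ (dirK c n *ᵥ x) = 0 := by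
  simp [dirW, dirK, dotProduct, Matrix.mulVec, Fin.sum_univ_three]; ring

/-- Second derivative at `0` of a real cubic `a₀ + a₁τ + a₂τ² + a₃τ³` is `2a₂`. [ours; elementary] -/
theorem iteratedDeriv_two_cubic (a₀ a₁ a₂ a₃ : ℝ) :
    iteratedDeriv 2 (fun τ : ℝ => a₀ + a₁ * τ + a₂ * τ ^ 2 + a₃ * τ ^ 3) 0 = 2 * a₂ := by
  have d1 : deriv (fun τ : ℝ => a₀ + a₁ * τ + a₂ * τ ^ 2 + a₃ * τ ^ 3) = fun τ => a₁ + 2 * a₂ * τ + 3 * a₃ * τ ^ 2 := by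
    funext τ
    have h : HasDerivAt (fun τ : ℝ => a₀ + a₁ * τ + a₂ * τ ^ 2 + a₃ * τ ^ 3)
        (0 + a₁ * 1 + a₂ * (↑2 * τ ^ (2 - 1) * 1) + a₃ * (↑3 * τ ^ (3 - 1) * 1)) τ :=
      (((hasDerivAt_const τ a₀).add ((hasDerivAt_id' τ).const_mul a₁)).add
        (((hasDerivAt_id' τ).pow 2).const_mul a₂)).add (((hasDerivAt_id' τ).pow 3).const_mul a₃)
    rw [h.deriv]; push_cast; ring
  have d2 : deriv (fun τ : ℝ => a₁ + 2 * a₂ * τ + 3 * a₃ * τ ^ 2) 0 = 2 * a₂ := by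
    have h : HasDerivAt (fun τ : ℝ => a₁ + 2 * a₂ * τ + 3 * a₃ * τ ^ 2)
        (0 + 2 * a₂ * 1 + 3 * a₃ * (↑2 * (0 : ℝ) ^ (2 - 1) * 1)) 0 :=
      ((hasDerivAt_const (0 : ℝ) a₁).add ((hasDerivAt_id' (0 : ℝ)).const_mul (2 * a₂))).add
        (((hasDerivAt_id' (0 : ℝ)).pow 2).const_mul (3 * a₃))
    rw [h.deriv]; push_cast; ring
  rw [iteratedDeriv_eq_iterate]
  show deriv (deriv fun τ : ℝ => a₀ + a₁ * τ + a₂ * τ ^ 2 + a₃ * τ ^ 3) 0 = 2 * a₂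
  rw [d1, d2]

/-- **φ_θ along an admissible line is quadratic** with `(lineFun φ_θ)''(0) = 2wᵀYw − θ|w|²` (the cubic coefficient `wᵀKw`
and the cross terms `xᵀKw + wᵀKx` vanish; K1Q1 §16.2). [ours; elementary] -/
theorem iteratedDeriv_two_payoff_line (θ : ℝ) (x : Vec3) (Y : Mat3) (c n : Vec3) :
    iteratedDeriv 2 (lineFun (payoff θ) x Y c n) 0
      = 2 * (dirW c n ⬝ᵥ (Y *ᵥ dirW c n)) - θ * (dirW c n ⬝ᵥ dirW c n) := by
  set w := dirW c n with hw
  set K := dirK c n with hK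
  have hpoly : lineFun (payoff θ) x Y c n = fun τ : ℝ =>
      payoff θ x Y + (x ⬝ᵥ (Y *ᵥ w) + w ⬝ᵥ (Y *ᵥ x) + x ⬝ᵥ (K *ᵥ x) - θ * (x ⬝ᵥ w)) * τ
        + (w ⬝ᵥ (Y *ᵥ w) + (x ⬝ᵥ (K *ᵥ w) + w ⬝ᵥ (K *ᵥ x)) - θ / 2 * (w ⬝ᵥ w)) * τ ^ 2
        + (w ⬝ᵥ (K *ᵥ w)) * τ ^ 3 := by
    funext τ
    simp only [lineFun, payoff, ← hw, ← hK]
    simp [dotProduct, Matrix.mulVec, Fin.sum_univ_three, Matrix.add_apply, Pi.add_apply, Pi.smul_apply, smul_eq_mul]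
    ring
  rw [hpoly, iteratedDeriv_two_cubic, cross_dirK_dirW]
  ring

/-- **THE SUPERSOLUTION LEMMA, member form** (`CERTIFICATE-MAP-R18.md` §1 verbatim with the member abstract): for
`U = φ_θ + W` with `W` of class `C²` along lines, (S2) `W(0,0) ≤ 0`, (S1) `0 ≤ W(x, Y)` on `{|x| ≤ 1} × {Y symmetric
trace-free}`, and (LC) `2wᵀYw + ∂²_τ W(x + τw, Y + τK)|₀ ≤ θ` for every base point of the OPEN unit ball and every UNIT
admissible pair (`|c| = |n| = 1`, `c ⊥ n`, `w = n × c`, `K = sym(c⊗n)`), one has `RatioBound θ` (hence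
`laminateSupConst ≤ θ`).  For R18: `W := W_y`, `θ := θ₁ = fl(0.78)`; (S1) ← `R18_S1`, (LC) ← `R18_LC`, (S2) by
evaluation, smoothness routine.  Search for candidate a priori estimates; no regularity claim. [ours; elementary] -/
theorem ratioBound_of_member (θ : ℝ) (W : Vec3 → Mat3 → ℝ) (hS2 : W 0 0 ≤ 0)
    (hS1 : ∀ (x : Vec3) (Y : Mat3), Y.IsSymm → Y.trace = 0 → x ⬝ᵥ x ≤ 1 → 0 ≤ W x Y)
    (hsmooth : ∀ (x : Vec3) (Y : Mat3) (c n : Vec3), Y.IsSymm → Y.trace = 0 → c ⬝ᵥ n = 0 →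
      ContDiff ℝ 2 (fun τ : ℝ => W (x + τ • dirW c n) (Y + τ • dirK c n)))
    (hLC : ∀ (x : Vec3) (Y : Mat3) (c n : Vec3), Y.IsSymm → Y.trace = 0 → c ⬝ᵥ c = 1 → n ⬝ᵥ n = 1 → c ⬝ᵥ n = 0 →
      x ⬝ᵥ x < 1 →
      2 * (dirW c n ⬝ᵥ (Y *ᵥ dirW c n)) + iteratedDeriv 2 (fun τ : ℝ => W (x + τ • dirW c n) (Y + τ • dirK c n)) 0 ≤ θ) :
    RatioBound θ := by
  -- smoothness of the payoff along lines: it is a polynomial in τ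
  have hpay : ∀ (x w : Vec3) (Y K : Mat3), ContDiff ℝ 2 (fun τ : ℝ => payoff θ (x + τ • w) (Y + τ • K)) := by
    intro x w Y K
    have : (fun τ : ℝ => payoff θ (x + τ • w) (Y + τ • K)) = fun τ : ℝ =>
        payoff θ x Y + (x ⬝ᵥ (Y *ᵥ w) + w ⬝ᵥ (Y *ᵥ x) + x ⬝ᵥ (K *ᵥ x) - θ * (x ⬝ᵥ w)) * τ
          + (w ⬝ᵥ (Y *ᵥ w) + (x ⬝ᵥ (K *ᵥ w) + w ⬝ᵥ (K *ᵥ x)) - θ / 2 * (w ⬝ᵥ w)) * τ ^ 2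
          + (w ⬝ᵥ (K *ᵥ w)) * τ ^ 3 := by
      funext τ
      simp only [payoff]
      simp [dotProduct, Matrix.mulVec, Fin.sum_univ_three, Matrix.add_apply, Pi.add_apply, Pi.smul_apply, smul_eq_mul]
      ring
    rw [this]
    fun_prop
  refine ratioBound_of_unitDir_deriv2 (fun x Y => payoff θ x Y + W x Y) ?_ ?_ ?_ ?_
  · -- (S2): φ_θ(0,0) = 0
    have : payoff θ 0 0 = 0 := by simp [payoff]
    rw [this, zero_add]; exact hS2
  · -- (S1)
    intro x Y hY htr hx
    have := hS1 x Y hY htr hx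
    linarith
  · -- C² along admissible lines inside the symmetric trace-free cone
    intro x Y c n hY htr hcn
    exact (hpay x (dirW c n) Y (dirK c n)).add (hsmooth x Y c n hY htr hcn)
  · -- (LC)
    intro x Y c n hY htr hc hn hcn hx
    have hw1 : dirW c n ⬝ᵥ dirW c n = 1 := by rw [dirW_dot_self, hc, hn, hcn]; norm_num
    have h1 : ContDiffAt ℝ 2 (lineFun (payoff θ) x Y c n) 0 := (hpay x (dirW c n) Y (dirK c n)).contDiffAt
    have h2 : ContDiffAt ℝ 2 (fun τ : ℝ => W (x + τ • dirW c n) (Y + τ • dirK c n)) 0 :=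
      (hsmooth x Y c n hY htr hcn).contDiffAt
    have hsum : lineFun (fun x Y => payoff θ x Y + W x Y) x Y c n
        = fun τ => lineFun (payoff θ) x Y c n τ + (fun τ : ℝ => W (x + τ • dirW c n) (Y + τ • dirK c n)) τ := by
      funext τ; rfl
    rw [hsum, iteratedDeriv_fun_add h1 h2, iteratedDeriv_two_payoff_line, hw1]
    have := hLC x Y c n hY htr hc hn hcn hx
    linarith

/-- Member form ⇒ `laminateSupConst ≤ θ`. [ours; elementary] -/
theorem laminateSupConst_le_of_member (θ : ℝ) (W : Vec3 → Mat3 → ℝ) (hS2 : W 0 0 ≤ 0)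
    (hS1 : ∀ (x : Vec3) (Y : Mat3), Y.IsSymm → Y.trace = 0 → x ⬝ᵥ x ≤ 1 → 0 ≤ W x Y)
    (hsmooth : ∀ (x : Vec3) (Y : Mat3) (c n : Vec3), Y.IsSymm → Y.trace = 0 → c ⬝ᵥ n = 0 →
      ContDiff ℝ 2 (fun τ : ℝ => W (x + τ • dirW c n) (Y + τ • dirK c n)))
    (hLC : ∀ (x : Vec3) (Y : Mat3) (c n : Vec3), Y.IsSymm → Y.trace = 0 → c ⬝ᵥ c = 1 → n ⬝ᵥ n = 1 → c ⬝ᵥ n = 0 →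
      x ⬝ᵥ x < 1 →
      2 * (dirW c n ⬝ᵥ (Y *ᵥ dirW c n)) + iteratedDeriv 2 (fun τ : ℝ => W (x + τ • dirW c n) (Y + τ • dirK c n)) 0 ≤ θ) :
    laminateSupConst ≤ θ :=
  laminateSupConst_le_of_ratioBound (ratioBound_of_member θ W hS2 hS1 hsmooth hLC)

end memberForm

end Laminate

end Summit.NavierStokesRegularity.FunctionalMining

end
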